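import Summits.QuantumFields.YangMills.Theorems.ColdStartUniversalityLatticeLangevinNoiseRotation
import HarnessLib

/-!
# Route `ColdStartUniversality` (brick «G4(i)» of gauge covariance in law of the SZZ dynamics):
# AN ORTHOGONAL TRANSFORMATION OF A FLAT NOISE GENERATES THE SAME RAW NATURAL FILTRATION

Helper file (seat `ym-line-csu-p1`, g10; `--supports stmt-QuantumFields-24809`).  For a flat Brownian noise
`W : ℝ≥0 → Ω → (Edge d L × κ → ℝ)` and a real matrix `R` on the index set with `Rᵀ R = 1`, the transformed noise
`W^R t ω i = Σⱼ R i j · W t ω j` (flat by `NoiseRotation.isFlatBrownian_orthogonal`) has THE SAME natural filtration: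
`(isFlatBrownian_orthogonal hW R hR).natFiltration = hW.natFiltration` (`natFiltration_orthogonal_eq`) — `x ↦ R x` is a measurable
equivalence of the coordinate space with inverse `x ↦ Rᵀ x` (built inline), so `σ(W^R_s) = σ(W_s)` for every `s`.  Hence a process is
adapted / an Itô integral is taken w.r.t. one filtration iff w.r.t. the other: step (i) of the transfer of `IsSolution` to the
gauge-transformed solution driven by the rotated noise (CSU lead memo §4).  THEOREMS ONLY, [folklore];
no crux or summit is proved; the Yang–Mills mass gap is NOT proved.
-/

noncomputable section

open MeasureTheory ProbabilityTheory
open scoped NNReal ENNReal BigOperators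

namespace Summit.QuantumFields.YangMills.Theorems.ColdStartUniversality.NoiseRotation

open Literature.Probability.Process Literature.MathematicalPhysics.QuantumFieldTheory

variable {ι : Type*} [Fintype ι] [DecidableEq ι]

omit [DecidableEq ι] in
/-- `x ↦ R x` is measurable on `ι → ℝ`. [folklore] -/
theorem measurable_mulVec' (R : Matrix ι ι ℝ) : Measurable fun x : ι → ℝ => R.mulVec x := by
  refine measurable_pi_lambda _ fun i => ?_
  simp only [Matrix.mulVec, dotProduct]
  exact Finset.measurable_sum _ fun j _ => (measurable_pi_apply j).const_mul _

variable {d L : ℕ} [NeZero L] {κ : Type*} [Fintype κ] [DecidableEq κ] {Ω : Type*} {mΩ : MeasurableSpace Ω}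
  {P : Measure Ω}

/-- ★ **The rotated flat noise generates the same raw natural filtration**:
`(isFlatBrownian_orthogonal hW R hR).natFiltration = hW.natFiltration`. [folklore] -/
theorem natFiltration_orthogonal_eq {W : ℝ≥0 → Ω → (Edge d L × κ → ℝ)} (hW : IsFlatBrownian W P)
    (R : Matrix (Edge d L × κ) (Edge d L × κ) ℝ) (hR : R.transpose * R = 1) :
    (isFlatBrownian_orthogonal hW R hR).natFiltration = hW.natFiltration := by
  classical
  refine Filtration.ext ?_
  funext t
  change (⨆ j ≤ t, MeasurableSpace.comap (fun ω i => ∑ k, R i k * W j ω k) inferInstance) =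
    ⨆ j ≤ t, MeasurableSpace.comap (W j) inferInstance
  refine iSup_congr fun j => iSup_congr fun _ => ?_
  -- `x ↦ R x` as a measurable equivalence of the coordinate space (inverse `x ↦ Rᵀ x`)
  let φ : (Edge d L × κ → ℝ) ≃ᵐ (Edge d L × κ → ℝ) :=
    { toFun := fun x => R.mulVec x
      invFun := fun x => R.transpose.mulVec x
      left_inv := fun x => by
        show R.transpose.mulVec (R.mulVec x) = x
        rw [Matrix.mulVec_mulVec, hR, Matrix.one_mulVec]
      right_inv := fun x => by
        show R.mulVec (R.transpose.mulVec x) = x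
        rw [Matrix.mulVec_mulVec, mul_eq_one_comm.mp hR, Matrix.one_mulVec]
      measurable_toFun := measurable_mulVec' R
      measurable_invFun := measurable_mulVec' R.transpose }
  have hφ : (fun ω i => ∑ k, R i k * W j ω k) = φ ∘ W j := by
    funext ω i
    rfl
  rw [hφ, ← MeasurableSpace.comap_comp, φ.measurableEmbedding.comap_eq]

end Summit.QuantumFields.YangMills.Theorems.ColdStartUniversality.NoiseRotation

end
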